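import Summits.QuantumFields.BalabanUV.Beta.GAN24.OneStepLoopCovarianceInputTriple
import Summits.QuantumFields.BalabanUV.Beta.GAN24.DiagramVolumeLimitOneLoop

/-!
# `BalabanUV.Beta.GAN24.OneStepLoopContraction` — binder row G-an2-4 ∕ (CONV-C), routes C-R6° («VALUES») × R7 («TWO CURRENCIES»), PART 196:
# THE ONE-LOOP CONTRACTION `Γ₁(Y ⊗ₖ Y)Γ₂ᴴ` OF ANY INPUT TRIPLE, AND OF THE LOOP COVARIANCE `Y = c⁻¹𝒢c⁻¹` OF CENSUS V196, ON `ℤ^d` — MODULO ONLY THE LEGS.  PART 132 ∕ 153 proved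
# (UD)+(SR) and the `ℤ^d` END of the dressed one-loop diagram `Γ₁(Σ_k ⊗ₖ Σ_k)Γ₂ᴴ` of the effective form; their proofs use `Σ_k` only through its INPUT triple.  This file states the GENERIC
# versions — for ANY volume-indexed tower `Y_t` carrying (UD) `EntryDecay (distK) (Y_t k) B κ`, (SR) `TwoLevelDecayRate (distK) Y_t B′ κ θ` (`θ < 1`) and EL₂ at unit readings, and all legs
# with PART 132's two-point decay at rate `κ` and EL₃ — and instantiates them with PART 195's loop covariance `Y_t k = c_{k,t}⁻¹·X_t k·c_{k,t}⁻¹` along every cubic coarse volume sequence: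
# census V196 (ζ) = V201‴ (ζ) CLOSED at PART 153's level (the legs — row an1's Table-T words — remain the displayed input, as there) (unit b2b-balaban-gan24-p3, gen 61; v1)

NOT IN PRINT; OUR PROOF ([folklore] bookkeeping BY NAME over PART 131 `DiagramDecayVertices` (`entryDecay_vertexDress`, `twoLevelDecayRate_vertexDress`), PART 130 `DiagramDecayAlgebra`
(`entryDecay_kronecker`, `twoLevelDecayRate_kronecker`), PART 132 `DiagramDecayTorus` (`sum_exp_pairDistK_le`, `distK_legs_laws`), PART 140 `DiagramVolumeLimit.conv_of_decay_of_tendsto`, PART 150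
`DiagramVolumeLimitLegs.tendsto_legs_pair`, PART 153 `DiagramVolumeLimitOneLoop.exp_distK_le_exp_window_pair'`, PART 143 `DiagramVolumeLimitSandwich.norm_le_of_entryDecay`, PART 195
`OneStepLoopCovarianceInputTriple.exists_loopCov_inputs`; [Balaban1987RG1] (1.20)–(1.22) p. 264 LOCATE the one-loop shape and the `T ↗ ℤ^d` limit; nothing printed is a hypothesis).
HONEST FRAMING (cell contract, verbatim): «discharging `BetaPertH` makes Bałaban's UV stability UNCONDITIONAL — a real constructive-QFT result; it is NOT the
continuum limit and NOT the Clay problem.»  HONEST DEPENDENCY (verbatim): «continuum YM on T⁴ ⇐ BetaPertH ∧ nine spine estimates (0/9 proved); BetaPertH ⇐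
(D1) ∧ (D4) ∧ CAP+tail; G-an2-4 gates asym, D1 and NE2/3/4.»

WHAT THIS FILE PROVES (0 sorry, 0 `def`):
* §1 **`decay_oneLoop_of_inputs`** — (UD)+(SR) of `Γ₁(Y_k ⊗ₖ Y_k)Γ₂ᴴ` at rate `κ∕4` with constants `γ₁γ₂C`, `γ₁γ₂C′` (`C, C′` from `(d, κ, B, B′)` only), for ANY tower with the triple's two decay clauses
  on a torus and legs decaying at rate `κ` (PART 132 verbatim with `Σ_k` replaced by a hypothesis).
* §2 **`conv_oneLoop_of_inputs`** — the `ℤ^d` END (`IsInfiniteVolumeLimit`, `UniformDecay`, `StepRate θ`, `KernelInputs`, second-moment convergence) of `Γ₁(Y_t k ⊗ₖ Y_t k)Γ₂_tᴴ` along any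
  cubic volume sequence for ANY volume-indexed INPUT triple `Y_t` (`θ < 1`) and legs with decay + EL₃ (PART 153 verbatim with `Σ_k` replaced by a hypothesis).
* §3 **`conv_oneLoop_loopCov`** — §2 for PART 195's loop covariance `Y = c⁻¹𝒢c⁻¹` of the gauge-fixed one-loop step, dimension `d + 1 ≥ 2`, `L ≥ 2`, every `Lb`, `a, a′`, every cubic coarse volume
  sequence; NO residual hypothesis beyond the legs; **`conv_oneLoop_loopCov_of_rate`** — the same for legs at ANY prescribed rate `κ_Γ > 0` (conclusion at rate `min κ₀ κ_Γ`).
WHAT IT IS NOT: the legs themselves (row an1's Table-T insertion words and their EL₃; PART 159 gives their decay for Lipschitz backgrounds); the tadpole terms (one two-vertex leg — same shape);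
first-order MODEL framing unchanged.  SUPPLIER work; NEVER «G-an2-4 closed»; NOT (CONV-C), NOT D1, NOT `BetaPertH`, NOT continuum, NOT Clay.  Records: `HOME/b2b-balaban-gan24-p3/gen61/README.md`.
-/

noncomputable section

open scoped BigOperators ComplexConjugate Matrix Matrix.Norms.L2Operator Kronecker
open Filter Topology Finset Matrix

namespace Summit.QuantumFields.BalabanUV.Beta.GAN24.OneStepLoopContraction

open Literature.MathematicalPhysics.QuantumFieldTheory.Balaban1983to89
open Literature.MathematicalPhysics.QuantumFieldTheory.Balaban1983to89.B5Prop11Plancherel (Tor fine)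
open Literature.MathematicalPhysics.QuantumFieldTheory.Balaban1983to89.B5RealFields (reM)
open Literature.MathematicalPhysics.QuantumFieldTheory.Balaban1983to89.B5G183RateUnitTower (lev)
open Literature.MathematicalPhysics.QuantumFieldTheory.Balaban1983to89.B12Sec2to5 (l1 betaPrime510)
open Literature.MathematicalPhysics.QuantumFieldTheory.Balaban1983to89.Beta (IsInfiniteVolumeLimit windowMap)
open Literature.MathematicalPhysics.QuantumFieldTheory.Balaban1983to89.Beta.FreeLegDictionary (cubic)
open Literature.MathematicalPhysics.QuantumFieldTheory.Balaban1983to89.Beta.VectorTails (castT)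
open Literature.MathematicalPhysics.QuantumFieldTheory.Balaban1983to89.Beta.LimitRate (StepRate limKernelOf KernelInputs)
open Literature.MathematicalPhysics.QuantumFieldTheory.Balaban1983to89.Beta.CompositionSingular (flucCov)
open Literature.MathematicalPhysics.QuantumFieldTheory.Balaban1983to89.Beta.BlockEffectiveAction (DelK)
open Summit.QuantumFields.BalabanUV.T4Continuum.BalabanLineAverage (QB)
open Summit.QuantumFields.BalabanUV.T4Continuum.BalabanAveragedTowerModes (par rem)
open Summit.QuantumFields.BalabanUV.T4Continuum.BalabanAveragedTowerUnit (idx unitCovB one_le_lev')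
open Summit.QuantumFields.BalabanUV.T4Continuum.BalabanAveragedCoerciveTower (unitIdx)
open Summit.QuantumFields.BalabanUV.T4Continuum.CTKingTowerWeights (distK)
open Summit.QuantumFields.BalabanUV.T4Continuum.DecayRateInterpolation (EntryDecay TwoLevelDecayRate)
open Summit.QuantumFields.BalabanUV.Beta.GAN24.DiagramDecayAlgebra (entryDecay_kronecker twoLevelDecayRate_kronecker twoLevelDecayRate_const_nonneg twoLevelDecayRate_of_le_rate)
open Summit.QuantumFields.BalabanUV.Beta.GAN24.DiagramDecayVertices (entryDecay_vertexDress twoLevelDecayRate_vertexDress)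
open Summit.QuantumFields.BalabanUV.Beta.GAN24.UnitLatticeDecayAlgebra (distK_nonneg)
open Summit.QuantumFields.BalabanUV.Beta.GAN24.EffectiveFormDecay (entryDecay_of_le_rate)
open Summit.QuantumFields.BalabanUV.Beta.GAN24.DiagramDecayTorus (sum_exp_pairDistK_le distK_legs_laws)
open Summit.QuantumFields.BalabanUV.Beta.GAN24.DiagramVolumeLimit (conv_of_decay_of_tendsto)
open Summit.QuantumFields.BalabanUV.Beta.GAN24.DiagramVolumeLimitSandwich (norm_le_of_entryDecay)
open Summit.QuantumFields.BalabanUV.Beta.GAN24.DiagramVolumeLimitLegs (tendsto_legs_pair)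
open Summit.QuantumFields.BalabanUV.Beta.GAN24.DiagramVolumeLimitOneLoop (exp_distK_le_exp_window_pair')
open Summit.QuantumFields.BalabanUV.Beta.GAN24.OneStepConstraintBlockPresentation (tree_cpt_add_off)
open Summit.QuantumFields.BalabanUV.Beta.GAN24.OneStepLoopCovarianceInputTriple (exists_loopCov_inputs)

variable {d : ℕ} (L : ℕ) [NeZero L]

/-! ## §1 (UD)+(SR) of the one-loop contraction of an INPUT triple -/

/-- **`decay_oneLoop_of_inputs` — (UD)+(SR) OF `Γ₁(Y_k ⊗ₖ Y_k)Γ₂ᴴ` FOR ANY TOWER WITH THE TRIPLE's DECAY CLAUSES** (`d ≥ 2`, `κ > 0`, `B, B′, θ ≥ 0`): `∃ C, C′ ≥ 0` (from `(d, κ, B, B′)`) such that on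
EVERY torus, for every tower `Y` with `EntryDecay distK (Y k) B κ` (all `k`) and `TwoLevelDecayRate distK Y B′ κ θ`, and all legs with `‖Γᵢ x q‖ ≤ γᵢe^{−κ(distK x q₁ + distK x q₂)}`:
`EntryDecay distK (Γ₁(Y_k ⊗ₖ Y_k)Γ₂ᴴ) (γ₁γ₂C) (κ∕4)` for all `k` and `TwoLevelDecayRate distK (k ↦ Γ₁(Y_k ⊗ₖ Y_k)Γ₂ᴴ) (γ₁γ₂C′) (κ∕4) θ` (PART 132's proof, verbatim). [folklore] -/
theorem decay_oneLoop_of_inputs (hd : 2 ≤ d) {B B' κ θ : ℝ} (hκ : 0 < κ) (hB : 0 ≤ B) (hB' : 0 ≤ B') (hθ : 0 ≤ θ) :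
    ∃ C C' : ℝ, 0 ≤ C ∧ 0 ≤ C' ∧ ∀ (M : Fin d → ℕ) [∀ μ, NeZero (M μ)] (Y : ℕ → Matrix (idx L M 0) (idx L M 0) ℂ),
      (∀ k, EntryDecay (distK L M) (Y k) B κ) → TwoLevelDecayRate (distK L M) Y B' κ θ →
      ∀ (γ₁ γ₂ : ℝ), 0 ≤ γ₁ → 0 ≤ γ₂ → ∀ (Γ₁ Γ₂ : Matrix (idx L M 0) (idx L M 0 × idx L M 0) ℂ),
      (∀ x q, ‖Γ₁ x q‖ ≤ γ₁ * Real.exp (-(κ * (distK L M x q.1 + distK L M x q.2)))) →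
      (∀ x q, ‖Γ₂ x q‖ ≤ γ₂ * Real.exp (-(κ * (distK L M x q.1 + distK L M x q.2)))) →
      (∀ k, EntryDecay (distK L M) (Γ₁ * (Y k ⊗ₖ Y k) * Γ₂ᴴ) (γ₁ * γ₂ * C) (κ / 4)) ∧
      TwoLevelDecayRate (distK L M) (fun k => Γ₁ * (Y k ⊗ₖ Y k) * Γ₂ᴴ) (γ₁ * γ₂ * C') (κ / 4) θ := by
  obtain ⟨S₁, hS₁0, hS₁⟩ := sum_exp_pairDistK_le (d := d) hd (half_pos hκ)
  obtain ⟨S₂, hS₂0, hS₂⟩ := sum_exp_pairDistK_le (d := d) hd (by positivity : 0 < κ / 4)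
  refine ⟨B * B * ((d * S₁) * (d * S₁) * ((d * S₂) * (d * S₂))), (B' * B + B * B') * ((d * S₁) * (d * S₁) * ((d * S₂) * (d * S₂))), by positivity, by positivity,
    fun M _ Y hud hsr γ₁ γ₂ hγ₁ hγ₂ Γ₁ Γ₂ hΓ₁ hΓ₂ => ?_⟩
  obtain ⟨hDp, hDD, hD0⟩ := distK_legs_laws L M
  have hpair0 : ∀ q r : idx L M 0 × idx L M 0, 0 ≤ distK L M q.1 r.1 + distK L M q.2 r.2 := fun q r => add_nonneg (distK_nonneg L M _ _) (distK_nonneg L M _ _)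
  have hK : ∀ k, EntryDecay (fun q r : idx L M 0 × idx L M 0 => distK L M q.1 r.1 + distK L M q.2 r.2) (Y k ⊗ₖ Y k) (B * B) κ := fun k => entryDecay_kronecker (hud k) (hud k)
  have hKr := twoLevelDecayRate_kronecker hud hud hsr hsr
  refine ⟨fun k => ?_, ?_⟩
  · have := entryDecay_vertexDress (dist := distK L M) (D := fun x (q : idx L M 0 × idx L M 0) => distK L M x q.1 + distK L M x q.2) hDp hDD hpair0 hD0 hκ.le hγ₁ hγ₂
      (mul_nonneg hB hB) (fun x => hS₁ L M (x, x)) (fun x => hS₂ L M (x, x)) hΓ₁ hΓ₂ (hK k)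
    exact fun x y => (this x y).trans (le_of_eq (by ring))
  · have := twoLevelDecayRate_vertexDress (dist := distK L M) (D := fun x (q : idx L M 0 × idx L M 0) => distK L M x q.1 + distK L M x q.2) hDp hDD hpair0 hD0 hκ.le hγ₁ hγ₂
      (by positivity : 0 ≤ B' * B + B * B') hθ (fun x => hS₁ L M (x, x)) (fun x => hS₂ L M (x, x)) hΓ₁ hΓ₂ hKr
    exact fun k x y => (this k x y).trans (le_of_eq (by ring))

/-! ## §2 The `ℤ^d` END of the one-loop contraction of an INPUT triple, modulo the legs -/

/-- **`conv_oneLoop_of_inputs` — THE ONE-LOOP CONTRACTION OF ANY INPUT TRIPLE ON `ℤ^d`, MODULO ONLY THE LEGS** (`d ≥ 2`, cubic `side t → ∞`, `κ > 0`, `0 ≤ θ < 1`, `μ ≠ ν`): for a volume-indexed tower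
`Y_t` with (UD) `(B, κ)`, (SR) `(B′, κ, θ)` and EL₂ at unit readings, `∃ C, C′ ≥ 0` such that for ALL `γ₁, γ₂ ≥ 0` and ALL legs `Γ₁_t, Γ₂_t` with PART 132's decay at rate `κ` and EL₃: `∃ Π` with
`IsInfiniteVolumeLimit side (Re (Γ₁_t(Y_t k ⊗ₖ Y_t k)Γ₂_tᴴ)(e(·,μ′),e(0,ν′))) (Π k)`, `UniformDecay Π μ ν (γ₁γ₂C) ((κ∕4)∕d)`, `StepRate Π μ ν (γ₁γ₂C′) ((κ∕4)∕d) θ`, `KernelInputs d Π`,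
`|secondMoment (Π k) μ ν − secondMoment Π_∞ μ ν| ≤ β′_d(γ₁γ₂C′∕(1−θ), (κ∕4)∕d)·θ^k` (PART 153's proof, verbatim). [cite: Balaban1987RG1, (1.21)–(1.22) p.264 (shapes)] [folklore] -/
theorem conv_oneLoop_of_inputs (hd : 2 ≤ d) {side : ℕ → ℕ} [∀ t, NeZero (side t)] (hside : Tendsto side atTop atTop)
    {Y : (t : ℕ) → ℕ → Matrix (idx L (cubic d (side t)) 0) (idx L (cubic d (side t)) 0) ℂ} {B B' κ θ : ℝ}
    (hκ : 0 < κ) (hB : 0 ≤ B) (hB' : 0 ≤ B') (hθ0 : 0 ≤ θ) (hθ1 : θ < 1)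
    (hud : ∀ t k, EntryDecay (distK L (cubic d (side t))) (Y t k) B κ) (hsr : ∀ t, TwoLevelDecayRate (distK L (cubic d (side t))) (Y t) B' κ θ)
    (hel : ∀ k (μ ν : Fin d) (z z' : Fin d → ℤ), ∃ s' : ℂ, Tendsto (fun t => Y t k ((unitIdx L (cubic d (side t))).symm (castT (cubic d (side t)) z, μ))
      ((unitIdx L (cubic d (side t))).symm (castT (cubic d (side t)) z', ν))) atTop (𝓝 s'))
    {μ ν : Fin d} (hne : μ ≠ ν) :
    ∃ C C' : ℝ, 0 ≤ C ∧ 0 ≤ C' ∧ ∀ (γ₁ γ₂ : ℝ), 0 ≤ γ₁ → 0 ≤ γ₂ →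
      ∀ (Γ₁ Γ₂ : (t : ℕ) → Matrix (idx L (cubic d (side t)) 0) (idx L (cubic d (side t)) 0 × idx L (cubic d (side t)) 0) ℂ),
      (∀ t x q, ‖Γ₁ t x q‖ ≤ γ₁ * Real.exp (-(κ * (distK L (cubic d (side t)) x q.1 + distK L (cubic d (side t)) x q.2)))) →
      (∀ t x q, ‖Γ₂ t x q‖ ≤ γ₂ * Real.exp (-(κ * (distK L (cubic d (side t)) x q.1 + distK L (cubic d (side t)) x q.2)))) →
      (∀ (μ' l l' : Fin d) (z u v : Fin d → ℤ), ∃ s' : ℂ, Tendsto (fun t => Γ₁ t ((unitIdx L (cubic d (side t))).symm (castT (cubic d (side t)) z, μ'))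
        ((unitIdx L (cubic d (side t))).symm (castT (cubic d (side t)) u, l), (unitIdx L (cubic d (side t))).symm (castT (cubic d (side t)) v, l'))) atTop (𝓝 s')) →
      (∀ (μ' l l' : Fin d) (z u v : Fin d → ℤ), ∃ s' : ℂ, Tendsto (fun t => Γ₂ t ((unitIdx L (cubic d (side t))).symm (castT (cubic d (side t)) z, μ'))
        ((unitIdx L (cubic d (side t))).symm (castT (cubic d (side t)) u, l), (unitIdx L (cubic d (side t))).symm (castT (cubic d (side t)) v, l'))) atTop (𝓝 s')) →
      ∃ Pinf : ℕ → B12Beta.Kernel d,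
        (∀ k, IsInfiniteVolumeLimit side
          (fun t μ' ν' (z : Beta.Site d (side t)) => ((Γ₁ t * (Y t k ⊗ₖ Y t k) * (Γ₂ t)ᴴ) ((unitIdx L (cubic d (side t))).symm (z, μ')) ((unitIdx L (cubic d (side t))).symm (0, ν'))).re) (Pinf k)) ∧
        Beta.LimitRate.UniformDecay Pinf μ ν (γ₁ * γ₂ * C) ((κ / 4) / d) ∧ StepRate Pinf μ ν (γ₁ * γ₂ * C') ((κ / 4) / d) θ ∧
        (∃ K : KernelInputs d Pinf, K.θ = θ ∧ K.c₀ = betaPrime510 d ((γ₁ * γ₂ * C') / (1 - θ)) ((κ / 4) / d) ∧ K.Pinf = limKernelOf Pinf ∧ K.μ = μ ∧ K.ν = ν) ∧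
        (∀ k, |B12Beta.secondMoment (Pinf k) μ ν - B12Beta.secondMoment (limKernelOf Pinf) μ ν| ≤ betaPrime510 d ((γ₁ * γ₂ * C') / (1 - θ)) ((κ / 4) / d) * θ ^ k) := by
  have hd1 : 1 ≤ d := le_trans (by norm_num) hd
  have hd0 : (0 : ℝ) < d := by exact_mod_cast lt_of_lt_of_le zero_lt_one hd1
  obtain ⟨C, C', hC, hC', h132⟩ := decay_oneLoop_of_inputs L hd hκ hB hB' hθ0
  refine ⟨C, C', hC, hC', fun γ₁ γ₂ hγ₁ hγ₂ Γ₁ Γ₂ hΓ₁ hΓ₂ hΓ₁el hΓ₂el => ?_⟩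
  have hudL : ∀ t k, EntryDecay (distK L (cubic d (side t))) (Γ₁ t * (Y t k ⊗ₖ Y t k) * (Γ₂ t)ᴴ) (γ₁ * γ₂ * C) (κ / 4) :=
    fun t => (h132 (cubic d (side t)) (Y t) (hud t) (hsr t) γ₁ γ₂ hγ₁ hγ₂ (Γ₁ t) (Γ₂ t) (hΓ₁ t) (hΓ₂ t)).1
  have hsrL : ∀ t, TwoLevelDecayRate (distK L (cubic d (side t))) (fun k => Γ₁ t * (Y t k ⊗ₖ Y t k) * (Γ₂ t)ᴴ) (γ₁ * γ₂ * C') (κ / 4) θ :=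
    fun t => (h132 (cubic d (side t)) (Y t) (hud t) (hsr t) γ₁ γ₂ hγ₁ hγ₂ (Γ₁ t) (Γ₂ t) (hΓ₁ t) (hΓ₂ t)).2
  -- the legs' window decay away from the root, rate `κ/d`
  have hwin : ∀ {γ : ℝ} (Γ : (t : ℕ) → Matrix (idx L (cubic d (side t)) 0) (idx L (cubic d (side t)) 0 × idx L (cubic d (side t)) 0) ℂ),
      (∀ t x q, ‖Γ t x q‖ ≤ γ * Real.exp (-(κ * (distK L (cubic d (side t)) x q.1 + distK L (cubic d (side t)) x q.2)))) → 0 ≤ γ →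
      ∀ t (x : Beta.Site d (side t)) (μ' : Fin d) (u : Beta.Site d (side t)) (l : Fin d) (v : Beta.Site d (side t)) (l' : Fin d),
        ‖Γ t ((unitIdx L (cubic d (side t))).symm (x, μ')) ((unitIdx L (cubic d (side t))).symm (u, l), (unitIdx L (cubic d (side t))).symm (v, l'))‖
          ≤ γ * (Real.exp (-(κ / d) * l1 (windowMap d (side t) (u - x))) * Real.exp (-(κ / d) * l1 (windowMap d (side t) (v - x)))) := by
    intro γ Γ hΓ hγ t x μ' u l v l'
    refine (hΓ t _ _).trans ?_
    rw [mul_add, neg_add, Real.exp_add]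
    exact mul_le_mul_of_nonneg_left (mul_le_mul (exp_distK_le_exp_window_pair' L (side t) hκ.le x μ' u l)
      (exp_distK_le_exp_window_pair' L (side t) hκ.le x μ' v l') (Real.exp_pos _).le (Real.exp_pos _).le) hγ
  refine conv_of_decay_of_tendsto L hd1 hside (by positivity : 0 < κ / 4) hθ0 hθ1 hudL hsrL ?_ hne
  intro k μ' ν' z
  have e0 : ∀ t, castT (cubic d (side t)) (0 : Fin d → ℤ) = 0 := fun t => by funext i; simp [castT]
  have hXb : ∀ t (i j : idx L (cubic d (side t)) 0), ‖Y t k i j‖ ≤ B := fun t i j => norm_le_of_entryDecay L (side t) hκ.le hB (hud t k) i j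
  obtain ⟨s', hs'⟩ := tendsto_legs_pair L (side := side) hside hB hXb hXb (hwin Γ₁ hΓ₁ hγ₁) (hwin Γ₂ hΓ₂ hγ₂) (div_pos hκ hd0)
    (fun μ₁ ν₁ w w' => hel k μ₁ ν₁ w w') (fun μ₁ ν₁ w w' => hel k μ₁ ν₁ w w') hΓ₁el hΓ₂el μ' ν' z 0
  refine ⟨s', hs'.congr fun t => ?_⟩
  rw [e0]

/-! ## §3 The one-loop contraction of the loop covariance `Y = c⁻¹𝒢c⁻¹` -/

section LoopCov

variable (Lb : ℕ) [NeZero Lb] (a : ℝ) (ha : 0 < a) (s : ℕ → ℕ) [hs0 : ∀ t, NeZero (s t)]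

/-- **`conv_oneLoop_loopCov` — CENSUS V196 (ζ): THE ONE-LOOP CONTRACTION `Γ₁(Y ⊗ₖ Y)Γ₂ᴴ` OF THE LOOP COVARIANCE `Y = c⁻¹𝒢c⁻¹` OF THE GAUGE-FIXED ONE-LOOP STEP ON `ℤ^{d+1}`, MODULO ONLY THE LEGS**
(dimension `d + 1 ≥ 2`, `L ≥ 2`, every `Lb ≥ 1`, all `a, a′ > 0`, `μ ≠ ν`, every cubic coarse volume sequence `s t → ∞`; `M_t = fine (Lb·1) (cubic (d+1) (s t))`): §2 for PART 195's INPUT triple —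
`∃ κ₀ > 0, C, C′ ≥ 0` such that for all legs with two-point decay at rate `κ₀` and EL₃ the dressed contraction has limit kernels `Π` with `IsInfiniteVolumeLimit`, `UniformDecay Π μ ν (γ₁γ₂C) ((κ₀∕4)∕(d+1))`,
`StepRate … (√(L⁻¹))`, `KernelInputs`, second-moment convergence at ratio `√(L⁻¹)`.  NO residual hypothesis beyond the legs. [cite: Balaban1987RG1, (1.20)–(1.22) p.264 (shapes)] [folklore] -/
theorem conv_oneLoop_loopCov (hL : 2 ≤ L) (hd : 1 ≤ d) (hs : Tendsto s atTop atTop) {a' : ℝ} (ha' : 0 < a') {μ ν : Fin (d + 1)} (hne : μ ≠ ν) :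
    ∃ κ₀ C C' : ℝ, 0 < κ₀ ∧ 0 ≤ C ∧ 0 ≤ C' ∧ ∀ (γ₁ γ₂ : ℝ), 0 ≤ γ₁ → 0 ≤ γ₂ →
      ∀ (Γ₁ Γ₂ : (t : ℕ) → Matrix (idx L (fine (Lb * 1) (cubic (d + 1) (s t))) 0) (idx L (fine (Lb * 1) (cubic (d + 1) (s t))) 0 × idx L (fine (Lb * 1) (cubic (d + 1) (s t))) 0) ℂ),
      (∀ t x q, ‖Γ₁ t x q‖ ≤ γ₁ * Real.exp (-(κ₀ * (distK L (fine (Lb * 1) (cubic (d + 1) (s t))) x q.1 + distK L (fine (Lb * 1) (cubic (d + 1) (s t))) x q.2)))) →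
      (∀ t x q, ‖Γ₂ t x q‖ ≤ γ₂ * Real.exp (-(κ₀ * (distK L (fine (Lb * 1) (cubic (d + 1) (s t))) x q.1 + distK L (fine (Lb * 1) (cubic (d + 1) (s t))) x q.2)))) →
      (∀ (μ' l l' : Fin (d + 1)) (z u v : Fin (d + 1) → ℤ), ∃ s' : ℂ, Tendsto (fun t => Γ₁ t ((unitIdx L (fine (Lb * 1) (cubic (d + 1) (s t)))).symm (castT (fine (Lb * 1) (cubic (d + 1) (s t))) z, μ')) (((unitIdx L (fine (Lb * 1) (cubic (d + 1) (s t)))).symm (castT (fine (Lb * 1) (cubic (d + 1) (s t))) u, l)), ((unitIdx L (fine (Lb * 1) (cubic (d + 1) (s t)))).symm (castT (fine (Lb * 1) (cubic (d + 1) (s t))) v, l')))) atTop (𝓝 s')) →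
      (∀ (μ' l l' : Fin (d + 1)) (z u v : Fin (d + 1) → ℤ), ∃ s' : ℂ, Tendsto (fun t => Γ₂ t ((unitIdx L (fine (Lb * 1) (cubic (d + 1) (s t)))).symm (castT (fine (Lb * 1) (cubic (d + 1) (s t))) z, μ')) (((unitIdx L (fine (Lb * 1) (cubic (d + 1) (s t)))).symm (castT (fine (Lb * 1) (cubic (d + 1) (s t))) u, l)), ((unitIdx L (fine (Lb * 1) (cubic (d + 1) (s t)))).symm (castT (fine (Lb * 1) (cubic (d + 1) (s t))) v, l')))) atTop (𝓝 s')) →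
      ∃ Pinf : ℕ → B12Beta.Kernel (d + 1),
        (∀ k, IsInfiniteVolumeLimit (fun t => Lb * 1 * s t)
          (fun t μ' ν' (z : Beta.Site (d + 1) (Lb * 1 * s t)) => ((Γ₁ t * (((unitCovB L (fine (Lb * 1) (cubic (d + 1) (s t))) a ha k)⁻¹ * (((flucCov (reM (DelK (lev L k) (one_le_lev' L k) (fine (Lb * 1) (cubic (d + 1) (s t))) a ha)) (Matrix.fromRows (reM (QB 1 Lb (cubic (d + 1) (s t)))) (fun (t' : {x : Tor (fine (Lb * 1) (cubic (d + 1) (s t))) × Fin (d + 1) // (∀ ν, ν < x.2 → ((rem 1 Lb (cubic (d + 1) (s t)) x.1 ν : ℕ)) = 0) ∧ ((rem 1 Lb (cubic (d + 1) (s t)) x.1 x.2 : ℕ)) + 1 < Lb}) (x : Tor (fine (Lb * 1) (cubic (d + 1) (s t))) × Fin (d + 1)) => if x = (Function.Embedding.subtype (fun x : Tor (fine (Lb * 1) (cubic (d + 1) (s t))) × Fin (d + 1) => (∀ ν, ν < x.2 → ((rem 1 Lb (cubic (d + 1) (s t)) x.1 ν : ℕ)) = 0) ∧ ((rem 1 Lb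 (cubic (d + 1) (s t)) x.1 x.2 : ℕ)) + 1 < Lb)) t' then (1 : ℝ) else 0))).map ((↑) : ℝ → ℂ)).submatrix (unitIdx L (fine (Lb * 1) (cubic (d + 1) (s t)))) (unitIdx L (fine (Lb * 1) (cubic (d + 1) (s t))))) * (unitCovB L (fine (Lb * 1) (cubic (d + 1) (s t))) a ha k)⁻¹) ⊗ₖ ((unitCovB L (fine (Lb * 1) (cubic (d + 1) (s t))) a ha k)⁻¹ * (((flucCov (reM (DelK (lev L k) (one_le_lev' L k) (fine (Lb * 1) (cubic (d + 1) (s t))) a ha)) (Matrix.fromRows (reM (QB 1 Lb (cubic (d + 1) (s t)))) (fun (t' : {x : Tor (fine (Lb * 1) (cubic (d + 1) (s t))) × Fin (d + 1) // (∀ ν, ν < x.2 → ((rem 1 Lb (cubic (d + 1) (s t)) x.1 ν : ℕ)) = 0) ∧ ((rem 1 Lb (cubic (d + 1) (s t)) x.1 x.2 : ℕ)) + 1 < Lb}) (x : Tor (fine (Lb * 1) (cubic (d + 1) (s t))) × Fin (d + 1)) => if x = (Function.Embedding.subtype (fun x : Tor (fine (Lb * 1) (cubic (d + 1) (s t)))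 × Fin (d + 1) => (∀ ν, ν < x.2 → ((rem 1 Lb (cubic (d + 1) (s t)) x.1 ν : ℕ)) = 0) ∧ ((rem 1 Lb (cubic (d + 1) (s t)) x.1 x.2 : ℕ)) + 1 < Lb)) t' then (1 : ℝ) else 0))).map ((↑) : ℝ → ℂ)).submatrix (unitIdx L (fine (Lb * 1) (cubic (d + 1) (s t)))) (unitIdx L (fine (Lb * 1) (cubic (d + 1) (s t))))) * (unitCovB L (fine (Lb * 1) (cubic (d + 1) (s t))) a ha k)⁻¹)) * (Γ₂ t)ᴴ) ((unitIdx L (fine (Lb * 1) (cubic (d + 1) (s t)))).symm (z, μ')) ((unitIdx L (fine (Lb * 1) (cubic (d + 1) (s t)))).symm (0, ν'))).re) (Pinf k)) ∧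
        Beta.LimitRate.UniformDecay Pinf μ ν (γ₁ * γ₂ * C) ((κ₀ / 4) / (((d + 1 : ℕ)) : ℝ)) ∧ StepRate Pinf μ ν (γ₁ * γ₂ * C') ((κ₀ / 4) / (((d + 1 : ℕ)) : ℝ)) (Real.sqrt ((L : ℝ)⁻¹)) ∧
        (∃ K : KernelInputs (d + 1) Pinf, K.θ = Real.sqrt ((L : ℝ)⁻¹) ∧ K.c₀ = betaPrime510 (d + 1) ((γ₁ * γ₂ * C') / (1 - Real.sqrt ((L : ℝ)⁻¹))) ((κ₀ / 4) / (((d + 1 : ℕ)) : ℝ)) ∧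
          K.Pinf = limKernelOf Pinf ∧ K.μ = μ ∧ K.ν = ν) ∧
        (∀ k, |B12Beta.secondMoment (Pinf k) μ ν - B12Beta.secondMoment (limKernelOf Pinf) μ ν|
            ≤ betaPrime510 (d + 1) ((γ₁ * γ₂ * C') / (1 - Real.sqrt ((L : ℝ)⁻¹))) ((κ₀ / 4) / (((d + 1 : ℕ)) : ℝ)) * Real.sqrt ((L : ℝ)⁻¹) ^ k) := by
  have hd' : 2 ≤ d + 1 := by omega
  have hL1 : (1 : ℝ) < L := by exact_mod_cast (lt_of_lt_of_le one_lt_two hL : 1 < L)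
  have hθ0 : 0 ≤ Real.sqrt ((L : ℝ)⁻¹) := Real.sqrt_nonneg _
  have hθ1 : Real.sqrt ((L : ℝ)⁻¹) < 1 := by
    rw [show (1 : ℝ) = Real.sqrt 1 from Real.sqrt_one.symm]
    exact Real.sqrt_lt_sqrt (inv_nonneg.mpr (Nat.cast_nonneg _)) (inv_lt_one_of_one_lt₀ hL1)
  have hside : Tendsto (fun t => Lb * 1 * s t) atTop atTop :=
    Filter.tendsto_atTop_mono (fun t => Nat.le_mul_of_pos_left _ (Nat.pos_of_ne_zero (NeZero.ne (Lb * 1)))) hs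
  obtain ⟨κ₀, B, B', hκ₀, hB, hud, hsr, hel⟩ := exists_loopCov_inputs L a ha Lb s hL hd hs ha'
  -- `B′ ≥ 0`: read the (SR) clause at `k = 0` on the diagonal (PART 130)
  have hB' : 0 ≤ B' := by
    haveI : Nonempty (idx L (fine (Lb * 1) (cubic (d + 1) (s 0))) 0) := ⟨(unitIdx L _).symm (0, μ)⟩
    exact twoLevelDecayRate_const_nonneg (hsr 0)
  obtain ⟨C, C', hC, hC', h⟩ := conv_oneLoop_of_inputs L hd' (side := fun t => Lb * 1 * s t) hside (Y := fun t k => ((unitCovB L (fine (Lb * 1) (cubic (d + 1) (s t))) a ha k)⁻¹ * (((flucCov (reM (DelK (lev L k) (one_le_lev' L k) (fine (Lb * 1) (cubic (d + 1) (s t))) a ha)) (Matrix.fromRows (reM (QB 1 Lb (cubic (d + 1) (s t)))) (fun (t' : {x : Tor (fine (Lb * 1) (cubic (d + 1) (s t))) × Fin (d + 1) // (∀ ν, ν < x.2 → ((rem 1 Lb (cubic (d + 1) (s t)) x.1 ν : ℕ)) = 0) ∧ ((rem 1 Lb (cubic (d + 1) (s t)) x.1 x.2 : ℕ)) + 1 <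 Lb}) (x : Tor (fine (Lb * 1) (cubic (d + 1) (s t))) × Fin (d + 1)) => if x = (Function.Embedding.subtype (fun x : Tor (fine (Lb * 1) (cubic (d + 1) (s t))) × Fin (d + 1) => (∀ ν, ν < x.2 → ((rem 1 Lb (cubic (d + 1) (s t)) x.1 ν : ℕ)) = 0) ∧ ((rem 1 Lb (cubic (d + 1) (s t)) x.1 x.2 : ℕ)) + 1 < Lb)) t' then (1 : ℝ) else 0))).map ((↑) : ℝ → ℂ)).submatrix (unitIdx L (fine (Lb * 1) (cubic (d + 1) (s t)))) (unitIdx L (fine (Lb * 1) (cubic (d + 1) (s t))))) * (unitCovB L (fine (Lb * 1) (cubic (d + 1) (s t))) a ha k)⁻¹)) hκ₀ hB hB' hθ0 hθ1 hud hsr hel hne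
  exact ⟨κ₀, C, C', hκ₀, hC, hC', h⟩

/-- **`conv_oneLoop_loopCov_of_rate` — §3 WITH THE LEGS' DECAY RATE PRESCRIBED BY THE CONSUMER** (same setting): for EVERY `κ_Γ > 0` there are `0 < κ₁ ≤ κ_Γ` and `C, C′ ≥ 0` such that §3's conclusion
(at rate `(κ₁∕4)∕(d+1)`) holds for ALL legs with two-point decay at the consumer's rate `κ_Γ` and EL₃ — so a leg supplier never has to meet the loop covariance's (existential) rate `κ₀`:
`κ₁ = min κ₀ κ_Γ`, monotonicity of (UD)∕(SR) in the rate (PARTs 128 ∕ 130) and of the legs' envelope. [folklore] -/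
theorem conv_oneLoop_loopCov_of_rate (hL : 2 ≤ L) (hd : 1 ≤ d) (hs : Tendsto s atTop atTop) {a' : ℝ} (ha' : 0 < a') {μ ν : Fin (d + 1)} (hne : μ ≠ ν) {κΓ : ℝ} (hκΓ : 0 < κΓ) :
    ∃ κ₁ C C' : ℝ, 0 < κ₁ ∧ κ₁ ≤ κΓ ∧ 0 ≤ C ∧ 0 ≤ C' ∧ ∀ (γ₁ γ₂ : ℝ), 0 ≤ γ₁ → 0 ≤ γ₂ →
      ∀ (Γ₁ Γ₂ : (t : ℕ) → Matrix (idx L (fine (Lb * 1) (cubic (d + 1) (s t))) 0) (idx L (fine (Lb * 1) (cubic (d + 1) (s t))) 0 × idx L (fine (Lb * 1) (cubic (d + 1) (s t))) 0) ℂ),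
      (∀ t x q, ‖Γ₁ t x q‖ ≤ γ₁ * Real.exp (-(κΓ * (distK L (fine (Lb * 1) (cubic (d + 1) (s t))) x q.1 + distK L (fine (Lb * 1) (cubic (d + 1) (s t))) x q.2)))) →
      (∀ t x q, ‖Γ₂ t x q‖ ≤ γ₂ * Real.exp (-(κΓ * (distK L (fine (Lb * 1) (cubic (d + 1) (s t))) x q.1 + distK L (fine (Lb * 1) (cubic (d + 1) (s t))) x q.2)))) →
      (∀ (μ' l l' : Fin (d + 1)) (z u v : Fin (d + 1) → ℤ), ∃ s' : ℂ, Tendsto (fun t => Γ₁ t ((unitIdx L (fine (Lb * 1) (cubic (d + 1) (s t)))).symm (castT (fine (Lb * 1) (cubic (d + 1) (s t))) z, μ')) (((unitIdx L (fine (Lb * 1) (cubic (d + 1) (s t)))).symm (castT (fine (Lb * 1) (cubic (d + 1) (s t))) u, l)), ((unitIdx L (fine (Lb * 1) (cubic (d + 1) (s t)))).symm (castT (fine (Lb * 1) (cubic (d + 1) (s t))) v, l')))) atTop (𝓝 s')) →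
      (∀ (μ' l l' : Fin (d + 1)) (z u v : Fin (d + 1) → ℤ), ∃ s' : ℂ, Tendsto (fun t => Γ₂ t ((unitIdx L (fine (Lb * 1) (cubic (d + 1) (s t)))).symm (castT (fine (Lb * 1) (cubic (d + 1) (s t))) z, μ')) (((unitIdx L (fine (Lb * 1) (cubic (d + 1) (s t)))).symm (castT (fine (Lb * 1) (cubic (d + 1) (s t))) u, l)), ((unitIdx L (fine (Lb * 1) (cubic (d + 1) (s t)))).symm (castT (fine (Lb * 1) (cubic (d + 1) (s t))) v, l')))) atTop (𝓝 s')) →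
      ∃ Pinf : ℕ → B12Beta.Kernel (d + 1),
        (∀ k, IsInfiniteVolumeLimit (fun t => Lb * 1 * s t)
          (fun t μ' ν' (z : Beta.Site (d + 1) (Lb * 1 * s t)) => ((Γ₁ t * (((unitCovB L (fine (Lb * 1) (cubic (d + 1) (s t))) a ha k)⁻¹ * (((flucCov (reM (DelK (lev L k) (one_le_lev' L k) (fine (Lb * 1) (cubic (d + 1) (s t))) a ha)) (Matrix.fromRows (reM (QB 1 Lb (cubic (d + 1) (s t)))) (fun (t' : {x : Tor (fine (Lb * 1) (cubic (d + 1) (s t))) × Fin (d + 1) // (∀ ν, ν < x.2 → ((rem 1 Lb (cubic (d + 1) (s t)) x.1 ν : ℕ)) = 0) ∧ ((rem 1 Lb (cubic (d + 1) (s t)) x.1 x.2 : ℕ)) + 1 < Lb}) (x : Tor (fine (Lb * 1) (cubic (d + 1) (s t))) × Fin (d + 1)) => if x = (Function.Embedding.subtype (fun x : Tor (fine (Lb * 1) (cubic (d + 1) (s t))) × Fin (d + 1) => (∀ ν, ν < x.2 → ((rem 1 Lb (cubic (d + 1) (s t)) x.1 ν : ℕ)) = 0) ∧ ((rem 1 Lb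 (cubic (d + 1) (s t)) x.1 x.2 : ℕ)) + 1 < Lb)) t' then (1 : ℝ) else 0))).map ((↑) : ℝ → ℂ)).submatrix (unitIdx L (fine (Lb * 1) (cubic (d + 1) (s t)))) (unitIdx L (fine (Lb * 1) (cubic (d + 1) (s t))))) * (unitCovB L (fine (Lb * 1) (cubic (d + 1) (s t))) a ha k)⁻¹) ⊗ₖ ((unitCovB L (fine (Lb * 1) (cubic (d + 1) (s t))) a ha k)⁻¹ * (((flucCov (reM (DelK (lev L k) (one_le_lev' L k) (fine (Lb * 1) (cubic (d + 1) (s t))) a ha)) (Matrix.fromRows (reM (QB 1 Lb (cubic (d + 1) (s t)))) (fun (t' : {x : Tor (fine (Lb * 1) (cubic (d + 1) (s t))) × Fin (d + 1) // (∀ ν, ν < x.2 → ((rem 1 Lb (cubic (d + 1) (s t)) x.1 ν : ℕ)) = 0) ∧ ((rem 1 Lb (cubic (d + 1) (s t)) x.1 x.2 : ℕ)) + 1 < Lb}) (x : Tor (fine (Lb * 1) (cubic (d + 1) (s t))) × Fin (d + 1)) => if x = (Function.Embedding.subtype (fun x : Tor (fine (Lb * 1) (cubic (d + 1) (s t)))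 × Fin (d + 1) => (∀ ν, ν < x.2 → ((rem 1 Lb (cubic (d + 1) (s t)) x.1 ν : ℕ)) = 0) ∧ ((rem 1 Lb (cubic (d + 1) (s t)) x.1 x.2 : ℕ)) + 1 < Lb)) t' then (1 : ℝ) else 0))).map ((↑) : ℝ → ℂ)).submatrix (unitIdx L (fine (Lb * 1) (cubic (d + 1) (s t)))) (unitIdx L (fine (Lb * 1) (cubic (d + 1) (s t))))) * (unitCovB L (fine (Lb * 1) (cubic (d + 1) (s t))) a ha k)⁻¹)) * (Γ₂ t)ᴴ) ((unitIdx L (fine (Lb * 1) (cubic (d + 1) (s t)))).symm (z, μ')) ((unitIdx L (fine (Lb * 1) (cubic (d + 1) (s t)))).symm (0, ν'))).re) (Pinf k)) ∧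
        Beta.LimitRate.UniformDecay Pinf μ ν (γ₁ * γ₂ * C) ((κ₁ / 4) / (((d + 1 : ℕ)) : ℝ)) ∧ StepRate Pinf μ ν (γ₁ * γ₂ * C') ((κ₁ / 4) / (((d + 1 : ℕ)) : ℝ)) (Real.sqrt ((L : ℝ)⁻¹)) ∧
        (∃ K : KernelInputs (d + 1) Pinf, K.θ = Real.sqrt ((L : ℝ)⁻¹) ∧ K.c₀ = betaPrime510 (d + 1) ((γ₁ * γ₂ * C') / (1 - Real.sqrt ((L : ℝ)⁻¹))) ((κ₁ / 4) / (((d + 1 : ℕ)) : ℝ)) ∧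
          K.Pinf = limKernelOf Pinf ∧ K.μ = μ ∧ K.ν = ν) ∧
        (∀ k, |B12Beta.secondMoment (Pinf k) μ ν - B12Beta.secondMoment (limKernelOf Pinf) μ ν|
            ≤ betaPrime510 (d + 1) ((γ₁ * γ₂ * C') / (1 - Real.sqrt ((L : ℝ)⁻¹))) ((κ₁ / 4) / (((d + 1 : ℕ)) : ℝ)) * Real.sqrt ((L : ℝ)⁻¹) ^ k) := by
  have hd' : 2 ≤ d + 1 := by omega
  have hL1 : (1 : ℝ) < L := by exact_mod_cast (lt_of_lt_of_le one_lt_two hL : 1 < L)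
  have hθ0 : 0 ≤ Real.sqrt ((L : ℝ)⁻¹) := Real.sqrt_nonneg _
  have hθ1 : Real.sqrt ((L : ℝ)⁻¹) < 1 := by
    rw [show (1 : ℝ) = Real.sqrt 1 from Real.sqrt_one.symm]
    exact Real.sqrt_lt_sqrt (inv_nonneg.mpr (Nat.cast_nonneg _)) (inv_lt_one_of_one_lt₀ hL1)
  have hside : Tendsto (fun t => Lb * 1 * s t) atTop atTop :=
    Filter.tendsto_atTop_mono (fun t => Nat.le_mul_of_pos_left _ (Nat.pos_of_ne_zero (NeZero.ne (Lb * 1)))) hs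
  obtain ⟨κ₀, B, B', hκ₀, hB, hud, hsr, hel⟩ := exists_loopCov_inputs L a ha Lb s hL hd hs ha'
  have hB' : 0 ≤ B' := by
    haveI : Nonempty (idx L (fine (Lb * 1) (cubic (d + 1) (s 0))) 0) := ⟨(unitIdx L _).symm (0, μ)⟩
    exact twoLevelDecayRate_const_nonneg (hsr 0)
  have hκ₁ : 0 < min κ₀ κΓ := lt_min hκ₀ hκΓ
  have hud₁ : ∀ t k, EntryDecay (distK L (fine (Lb * 1) (cubic (d + 1) (s t)))) (((unitCovB L (fine (Lb * 1) (cubic (d + 1) (s t))) a ha k)⁻¹ * (((flucCov (reM (DelK (lev L k) (one_le_lev' L k) (fine (Lb * 1) (cubic (d + 1) (s t))) a ha)) (Matrix.fromRows (reM (QB 1 Lb (cubic (d + 1) (s t)))) (fun (t' : {x : Tor (fine (Lb * 1) (cubic (d + 1) (s t))) × Fin (d + 1) // (∀ ν, ν < x.2 → ((rem 1 Lb (cubic (d + 1) (s t)) x.1 ν : ℕ)) = 0) ∧ ((rem 1 Lb (cubic (d + 1) (s t)) x.1 x.2 : ℕ)) + 1 < Lb}) (x : Tor (fine (Lb * 1)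 (cubic (d + 1) (s t))) × Fin (d + 1)) => if x = (Function.Embedding.subtype (fun x : Tor (fine (Lb * 1) (cubic (d + 1) (s t))) × Fin (d + 1) => (∀ ν, ν < x.2 → ((rem 1 Lb (cubic (d + 1) (s t)) x.1 ν : ℕ)) = 0) ∧ ((rem 1 Lb (cubic (d + 1) (s t)) x.1 x.2 : ℕ)) + 1 < Lb)) t' then (1 : ℝ) else 0))).map ((↑) : ℝ → ℂ)).submatrix (unitIdx L (fine (Lb * 1) (cubic (d + 1) (s t)))) (unitIdx L (fine (Lb * 1) (cubic (d + 1) (s t))))) * (unitCovB L (fine (Lb * 1) (cubic (d + 1) (s t))) a ha k)⁻¹)) B (min κ₀ κΓ) :=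
    fun t k => entryDecay_of_le_rate (distK_nonneg L _) (hud t k) hB (min_le_left _ _)
  have hsr₁ : ∀ t, TwoLevelDecayRate (distK L (fine (Lb * 1) (cubic (d + 1) (s t)))) (fun k => ((unitCovB L (fine (Lb * 1) (cubic (d + 1) (s t))) a ha k)⁻¹ * (((flucCov (reM (DelK (lev L k) (one_le_lev' L k) (fine (Lb * 1) (cubic (d + 1) (s t))) a ha)) (Matrix.fromRows (reM (QB 1 Lb (cubic (d + 1) (s t)))) (fun (t' : {x : Tor (fine (Lb * 1) (cubic (d + 1) (s t))) × Fin (d + 1) // (∀ ν, ν < x.2 → ((rem 1 Lb (cubic (d + 1) (s t)) x.1 ν : ℕ)) = 0) ∧ ((rem 1 Lb (cubic (d + 1) (s t)) x.1 x.2 : ℕ)) + 1 < Lb}) (x : Tor (fine (Lb * 1) (cubic (d + 1) (s t))) × Fin (d + 1)) => if x = (Function.Embedding.subtype (fun x : Tor (fine (Lb * 1) (cubic (d + 1) (s t))) × Fin (d + 1) => (∀ ν, ν < x.2 → ((rem 1 Lb (cubic (d + 1) (s t)) x.1 ν : ℕ)) = 0) ∧ ((rem 1 Lb (cubic (d + 1)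 (s t)) x.1 x.2 : ℕ)) + 1 < Lb)) t' then (1 : ℝ) else 0))).map ((↑) : ℝ → ℂ)).submatrix (unitIdx L (fine (Lb * 1) (cubic (d + 1) (s t)))) (unitIdx L (fine (Lb * 1) (cubic (d + 1) (s t))))) * (unitCovB L (fine (Lb * 1) (cubic (d + 1) (s t))) a ha k)⁻¹)) B' (min κ₀ κΓ) (Real.sqrt ((L : ℝ)⁻¹)) :=
    fun t => twoLevelDecayRate_of_le_rate (distK_nonneg L _) (hsr t) hB' hθ0 (min_le_left _ _)
  -- a leg envelope at rate `κ_Γ` is one at rate `min κ₀ κ_Γ`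
  have hweak : ∀ {γ : ℝ} (Γ : (t : ℕ) → Matrix (idx L (fine (Lb * 1) (cubic (d + 1) (s t))) 0) (idx L (fine (Lb * 1) (cubic (d + 1) (s t))) 0 × idx L (fine (Lb * 1) (cubic (d + 1) (s t))) 0) ℂ), 0 ≤ γ →
      (∀ t x q, ‖Γ t x q‖ ≤ γ * Real.exp (-(κΓ * (distK L (fine (Lb * 1) (cubic (d + 1) (s t))) x q.1 + distK L (fine (Lb * 1) (cubic (d + 1) (s t))) x q.2)))) →
      ∀ t x q, ‖Γ t x q‖ ≤ γ * Real.exp (-(min κ₀ κΓ * (distK L (fine (Lb * 1) (cubic (d + 1) (s t))) x q.1 + distK L (fine (Lb * 1) (cubic (d + 1) (s t))) x q.2))) := by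
    intro γ Γ hγ hΓ t x q
    refine (hΓ t x q).trans (mul_le_mul_of_nonneg_left (Real.exp_le_exp.mpr ?_) hγ)
    have h0 : 0 ≤ distK L (fine (Lb * 1) (cubic (d + 1) (s t))) x q.1 + distK L (fine (Lb * 1) (cubic (d + 1) (s t))) x q.2 := add_nonneg (distK_nonneg L _ _ _) (distK_nonneg L _ _ _)
    nlinarith [min_le_right κ₀ κΓ]
  obtain ⟨C, C', hC, hC', h⟩ := conv_oneLoop_of_inputs L hd' (side := fun t => Lb * 1 * s t) hside (Y := fun t k => ((unitCovB L (fine (Lb * 1) (cubic (d + 1) (s t))) a ha k)⁻¹ * (((flucCov (reM (DelK (lev L k) (one_le_lev' L k) (fine (Lb * 1) (cubic (d + 1) (s t))) a ha)) (Matrix.fromRows (reM (QB 1 Lb (cubic (d + 1) (s t)))) (fun (t' : {x : Tor (fine (Lb * 1) (cubic (d + 1) (s t))) × Fin (d + 1) // (∀ ν, ν < x.2 → ((rem 1 Lb (cubic (d + 1) (s t)) x.1 ν : ℕ)) = 0) ∧ ((rem 1 Lb (cubic (d + 1) (s t)) x.1 x.2 : ℕ)) + 1 < Lb}) (x : Tor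 (fine (Lb * 1) (cubic (d + 1) (s t))) × Fin (d + 1)) => if x = (Function.Embedding.subtype (fun x : Tor (fine (Lb * 1) (cubic (d + 1) (s t))) × Fin (d + 1) => (∀ ν, ν < x.2 → ((rem 1 Lb (cubic (d + 1) (s t)) x.1 ν : ℕ)) = 0) ∧ ((rem 1 Lb (cubic (d + 1) (s t)) x.1 x.2 : ℕ)) + 1 < Lb)) t' then (1 : ℝ) else 0))).map ((↑) : ℝ → ℂ)).submatrix (unitIdx L (fine (Lb * 1) (cubic (d + 1) (s t)))) (unitIdx L (fine (Lb * 1) (cubic (d + 1) (s t))))) * (unitCovB L (fine (Lb * 1) (cubic (d + 1) (s t))) a ha k)⁻¹)) hκ₁ hB hB' hθ0 hθ1 hud₁ hsr₁ hel hne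
  exact ⟨min κ₀ κΓ, C, C', hκ₁, min_le_right _ _, hC, hC', fun γ₁ γ₂ hγ₁ hγ₂ Γ₁ Γ₂ hΓ₁ hΓ₂ => h γ₁ γ₂ hγ₁ hγ₂ Γ₁ Γ₂ (hweak Γ₁ hγ₁ hΓ₁) (hweak Γ₂ hγ₂ hΓ₂)⟩

end LoopCov

end Summit.QuantumFields.BalabanUV.Beta.GAN24.OneStepLoopContraction

end
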